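import Literature.NumberTheory.LFunctions.RosserSchoenfeldPsiBound
import Literature.NumberTheory.LFunctions.ChebyshevPsiExplicitPartialRH
import Literature.NumberTheory.LFunctions.SchoenfeldPsiSmall
import HarnessLib

/-!
# Rosser–Schoenfeld 1962, Theorem 12 — DISCHARGED: `ψ(x) < 1.03883 x` for all `x > 0`, and the
# maximum of `ψ(x)/x` at `x = 113` (COMPUTATIONAL axiom closure above `x = 40000`)

LABEL (line 1): **RH-FREE** literature — our proof of an unconditional 1962 Chebyshev-function bound;
its axiom closure is COMPUTATIONAL (the certified zeros of `ζ` below height `2516`,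
`native_decide`, inherited from `ChebyshevPsiExplicitPartialRH.lean`; filed `--computational`).
bears_on: LADDER-RH §4 (seat of origin `rh-crit-gm`, NOT RH-BEARING) / W-P only as OPTIONAL consumer
infrastructure (the Weil-column `hRS` door; the standard-axiom Chebyshev door is the one of record).
WHAT THIS IS NOT: nothing in this file bears on the truth of RH; `ψ(x) < 1.04 x` is prime-counting
bookkeeping, and proving it moves RH by nothing.

Topic `Literature/NumberTheory/LFunctions`. Pure proof file for the NAMED FACT
`Literature.NumberTheory.LFunctions.RosserSchoenfeld1962_theorem_12` (`RosserSchoenfeldPsiBound.lean`,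
rh-crit gm-t2: `∀ x : ℝ, 0 < x → ψ x < 1.03883 * x`, `ψ` = Mathlib's `Chebyshev.psi`), i.e.
Rosser–Schoenfeld 1962, Theorem 12, eq. (3.35), p. 71 (read first-hand from the held copy
`paper:doi-10-1215-ijm-1255631807`):

> THEOREM 12. The quotient `ψ(x)/x` takes its maximum at `x = 113`, and `ψ(x) < 1.03883 x` (3.35)
> for `0 < x`.

* `RosserSchoenfeld1962_theorem_12_holds : RosserSchoenfeld1962_theorem_12` — the DISCHARGE of (3.35);
* `psi_div_le_psi_div_113 : 0 < x → ψ x / x ≤ ψ 113 / 113` — the theorem's first clause ("the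
  quotient takes its maximum at `x = 113`"), PROVED as a theorem (it was deliberately not typed as a
  conjunct of the fact), with `RosserSchoenfeldPsi.psi_113_div_bounds : 1.0388 < ψ(113)/113 < 1.03883`;
* the unconditional consumer shapes `psi_lt_rosserSchoenfeld : 0 < x → ψ x < 1.03883 x` and
  `psi_le_rosserSchoenfeld : 0 ≤ x → ψ x ≤ (103883/100000) x` (the latter = the Weil-column hypothesis
  `hRS` of `ThetaParams.uc_of_loss_lt_gain`, through gm-t2's bridge
  `psi_le_of_RosserSchoenfeld1962_theorem_12`);
* `psi_lt_of_le_forty_thousand` — the range `0 < x ≤ 40000` with STANDARD axioms only (kernel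
  certificate, no zeros of `ζ`).

## The proof (not the printed one)

Rosser–Schoenfeld (p. 77) verify Theorem 12 for `x ≤ 2000` against Gram's table of `ψ`, and above
`2000` use their Theorem 18 with Table III, (4.12) and the zero-based tables of `|ψ(x) − x| < εx`.
Here:

* `1 ≤ n ≤ 40000` — a KERNEL computation (`decide +kernel`, standard axioms) in the style of the
  tree's `SchoenfeldPsiSmall.lean`: with `L_n = lcm(1, …, n) = e^{ψ(n)}` (`Chebyshev.psi_eq_log_lcmUpto`)
  the check `RosserSchoenfeldPsi.psiCheck` verifies `L_n^{q_n} < 2^{k_n}` with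
  `k_n = ⌊10388 · q_n · n · 10⁶ / 6931471808⌋` (so `k_n log 2 ≤ 1.0388 q_n n`, `log 2 < 0.6931471808`),
  `q_n = 16` for `n ≤ 1000` and `q_n = 1` beyond, i.e. **`ψ(n) < 1.0388 n` for every `n ≤ 40000`
  other than `n = 113`**; at the extremal `n = 113` (where `1.03883 · 113 − ψ(113) = 0.0011`) it
  verifies the two-sided window `2^{346829} ≤ L_{113}^{2048} < 2^{346837}`, i.e.
  `1.0388 · 113 < ψ(113) < 1.03883 · 113` (`0.6931471803 < log 2`). The margins elsewhere are
  comfortable (`≥ 0.29` nats below `10³`, `≥ 29` nats above), which is why `q = 16`, resp. `q = 1`,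
  suffice; `40000` integers of at most `6 · 10⁴` bits, a few seconds of kernel time.
* `x ≥ 40000` — the TREE theorem `PsiFromZeros2516.psi_sub_self_le`
  (`ChebyshevPsiExplicitPartialRH.lean`): `ψ(x) − x ≤ 0.00862 x + 5.72 √x` for `x ≥ 9`, from the
  four-fold differenced explicit formula and the certified first `2000` zeros of `ζ`; for
  `√x ≥ 200` this is `< 1.0388 x` since `5.72 √x ≤ 0.0286 x`. This leg (and hence `_holds`) is
  COMPUTATIONAL in the gate's sense: its axiom closure contains the `native_decide` certificates of
  `MertensCertificate` / `SchoenfeldZerosLow`, exactly as for its parent file. The range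
  `0 < x ≤ 40000` alone is recorded with standard axioms only (`psi_lt_of_le_forty_thousand`).

So for every real `x > 0` with `⌊x⌋ ≠ 113`: `ψ(x) = ψ(⌊x⌋) < 1.0388 ⌊x⌋ ≤ 1.0388 x`, and
`1.0388 < ψ(113)/113 < 1.03883` gives both printed clauses; on `[113, 114)` they read
`ψ(113)/x ≤ ψ(113)/113` and `ψ(113) < 1.03883 · 113 ≤ 1.03883 x`.

## References

* J. B. Rosser, L. Schoenfeld, *Approximate formulas for some functions of prime numbers*, Illinois
  J. Math. 6 (1962), 64–94, Theorem 12, eq. (3.35), p. 71; proof p. 77. [RosserSchoenfeld1962]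
* J. B. Rosser, L. Schoenfeld, Math. Comp. 29 (1975), 243–269, Lemma 8 (the differenced explicit
  formula behind `PsiFromZeros2516`). [RosserSchoenfeld1975]
-/

open Real
open scoped Chebyshev

namespace Literature.NumberTheory.LFunctions

/-! ## The kernel certificate on `1 ≤ n ≤ 40000` -/

namespace RosserSchoenfeldPsi

/-- The exponent `q_n` of the check `L_n^{q_n} < 2^{k_n}`: `16` up to `10³` (margins `≥ 0.29` nats
need steps of `(log 2)/16`), `1` beyond (margins `≥ 29` nats). [folklore] -/
def qOf (n : ℕ) : ℕ := if n ≤ 1000 then 16 else 1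

/-- The budget `k_n = ⌊10388 · q_n · n · 10⁶ / 6931471808⌋`, so that `k_n · log 2 ≤ 1.0388 · q_n · n`
(`log 2 < 0.6931471808`). [folklore] -/
def kOf (n : ℕ) : ℕ := 10388 * qOf n * n * 1000000 / 6931471808

/-- One step of the certificate at `n` with `L = lcm(1, …, n)`: for `n ≠ 113`, `L^{q_n} < 2^{k_n}`
(`ψ(n) < 1.0388 n`); at the extremal `n = 113`, the window `2^{346829} ≤ L^{2048} < 2^{346837}`
(`1.0388 · 113 < ψ(113) < 1.03883 · 113`). [folklore] -/
def stepOK (n L : ℕ) : Bool :=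
  if n = 113 then decide (L ^ 2048 < 2 ^ 346837) && decide (2 ^ 346829 ≤ L ^ 2048)
  else decide (L ^ qOf n < 2 ^ kOf n)

/-- The certificate for `n+1, …, n+fuel`, carrying the running `L = lcm(1, …, n)`. [folklore] -/
def psiCheck : ℕ → ℕ → ℕ → Bool
  | _, _, 0 => true
  | n, L, fuel + 1 => stepOK (n + 1) (Nat.lcm (n + 1) L) && psiCheck (n + 1) (Nat.lcm (n + 1) L) fuel

/-- Soundness of `psiCheck`: from `L = lcmUpto n`, a passing run gives `stepOK m (lcmUpto m)` for
`n < m ≤ n + fuel`. [folklore] -/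
private theorem psiCheck_sound : ∀ (fuel n L : ℕ), psiCheck n L fuel = true → L = Nat.lcmUpto n →
    ∀ m, n < m → m ≤ n + fuel → stepOK m (Nat.lcmUpto m) = true := by
  intro fuel
  induction fuel with
  | zero => intro n L _ _ m h1 h2; omega
  | succ fuel ih =>
    intro n L h hL m h1 h2
    simp only [psiCheck, Bool.and_eq_true] at h
    obtain ⟨hstep, hrest⟩ := h
    have hL' : Nat.lcm (n + 1) L = Nat.lcmUpto (n + 1) := by rw [hL, SchoenfeldBound.lcmUpto_succ]
    rcases Nat.lt_or_ge (n + 1) m with hlt | hge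
    · exact ih (n + 1) _ hrest hL' m hlt (by omega)
    · have hm : m = n + 1 := by omega
      subst hm
      rwa [hL'] at hstep

set_option maxHeartbeats 0 in
/-- **The kernel computation**: `psiCheck 0 1 40000 = true` (`lcmUpto 0 = 1`); a few seconds of
kernel time, standard axioms. [cite: RosserSchoenfeld1962, Theorem 12] -/
theorem psiCheck_holds : psiCheck 0 1 40000 = true := by
  decide +kernel

/-- `stepOK n (lcmUpto n)` for `1 ≤ n ≤ 40000`. [cite: RosserSchoenfeld1962, Theorem 12] -/
theorem stepOK_lcmUpto {n : ℕ} (h1 : 1 ≤ n) (h2 : n ≤ 40000) : stepOK n (Nat.lcmUpto n) = true :=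
  psiCheck_sound 40000 0 1 psiCheck_holds (by simp [Nat.lcmUpto]) n h1 (by omega)

/-- Reading the generic step: for `n ≠ 113`, `(lcmUpto n)^{q_n} < 2^{k_n}`. [folklore] -/
private theorem pow_lt_of_stepOK {n L : ℕ} (h : stepOK n L = true) (hn : n ≠ 113) : L ^ qOf n < 2 ^ kOf n := by
  unfold stepOK at h
  rw [if_neg hn, decide_eq_true_eq] at h
  exact h

/-- Reading the step at `113`: `2^{346829} ≤ L^{2048} < 2^{346837}`. [folklore] -/
private theorem window_of_stepOK {L : ℕ} (h : stepOK 113 L = true) :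
    L ^ 2048 < 2 ^ 346837 ∧ 2 ^ 346829 ≤ L ^ 2048 := by
  unfold stepOK at h
  rw [if_pos rfl, Bool.and_eq_true, decide_eq_true_eq, decide_eq_true_eq] at h
  exact h

/-- `0 < q_n`. [folklore] -/
private theorem qOf_pos (n : ℕ) : 0 < qOf n := by
  unfold qOf; split_ifs <;> norm_num

/-- **`ψ(n) < 1.0388 n` for `1 ≤ n ≤ 40000`, `n ≠ 113`.** [cite: RosserSchoenfeld1962, Theorem 12] -/
theorem psi_nat_lt {n : ℕ} (h1 : 1 ≤ n) (h2 : n ≤ 40000) (h3 : n ≠ 113) : ψ (n : ℝ) < 1.0388 * n := by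
  have h := pow_lt_of_stepOK (stepOK_lcmUpto h1 h2) h3
  have hL0 : (0 : ℝ) < Nat.lcmUpto n := by exact_mod_cast Nat.lcmUpto_pos n
  have hq0 : (0 : ℝ) < qOf n := by exact_mod_cast qOf_pos n
  have hlog : (qOf n : ℝ) * Real.log (Nat.lcmUpto n) < kOf n * Real.log 2 := by
    have h' : ((Nat.lcmUpto n : ℝ)) ^ qOf n < (2 : ℝ) ^ kOf n := by exact_mod_cast h
    have := Real.log_lt_log (by positivity) h'
    rwa [Real.log_pow, Real.log_pow] at this
  have hk : (kOf n : ℝ) ≤ 10388 * qOf n * n * 1000000 / 6931471808 := by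
    have := Nat.cast_div_le (m := 10388 * qOf n * n * 1000000) (n := 6931471808) (α := ℝ)
    simpa [kOf] using this
  have hl2 := Real.log_two_lt_d9
  have hl2' := Real.log_two_gt_d9
  have h2nn : (0 : ℝ) ≤ Real.log 2 := by linarith
  have hkl : (kOf n : ℝ) * Real.log 2 ≤ 10388 * qOf n * n * 1000000 / 6931471808 * 0.6931471808 := by
    calc (kOf n : ℝ) * Real.log 2 ≤ 10388 * qOf n * n * 1000000 / 6931471808 * Real.log 2 :=
          mul_le_mul_of_nonneg_right hk h2nn
      _ ≤ 10388 * qOf n * n * 1000000 / 6931471808 * 0.6931471808 := by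
          apply mul_le_mul_of_nonneg_left hl2.le; positivity
  have hmain : (qOf n : ℝ) * Real.log (Nat.lcmUpto n) < qOf n * (1.0388 * n) := by
    have heq : (10388 : ℝ) * qOf n * n * 1000000 / 6931471808 * 0.6931471808 = qOf n * (1.0388 * n) := by
      ring
    linarith
  rw [Chebyshev.psi_eq_log_lcmUpto]
  exact lt_of_mul_lt_mul_left hmain hq0.le

/-- The window at `113` in logarithms: `2048 log L_{113} < 346837 log 2` and
`346829 log 2 ≤ 2048 log L_{113}` (no `linarith`-type tactic ever sees the `3.5·10⁵`-bit powers).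
[folklore] -/
private theorem log_window_113 :
    (2048 : ℝ) * Real.log (Nat.lcmUpto 113) < 346837 * Real.log 2 ∧
      (346829 : ℝ) * Real.log 2 ≤ 2048 * Real.log (Nat.lcmUpto 113) := by
  obtain ⟨hup, hlo⟩ := window_of_stepOK (stepOK_lcmUpto (n := 113) (by norm_num) (by norm_num))
  have hL0 : (0 : ℝ) < Nat.lcmUpto 113 := Nat.cast_pos.mpr (Nat.lcmUpto_pos 113)
  have hup' := (Nat.cast_lt (α := ℝ)).mpr hup
  have hlo' := (Nat.cast_le (α := ℝ)).mpr hlo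
  rw [Nat.cast_pow, Nat.cast_pow, Nat.cast_ofNat] at hup' hlo'
  have h1 := Real.log_lt_log (pow_pos hL0 2048) hup'
  have h2 := Real.log_le_log (pow_pos (by norm_num : (0 : ℝ) < 2) 346829) hlo'
  rw [Real.log_pow, Real.log_pow] at h1 h2
  push_cast at h1 h2
  exact ⟨h1, h2⟩

/-- `ψ(113) = log L_{113}`. [folklore] -/
private theorem psi_113_eq : ψ (113 : ℝ) = Real.log (Nat.lcmUpto 113) := by
  rw [show (113 : ℝ) = ((113 : ℕ) : ℝ) by norm_num, Chebyshev.psi_eq_log_lcmUpto]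

/-- **`ψ(113) < 1.03883 · 113`** (`L_{113}^{2048} < 2^{346837}`, `346837 · 0.6931471808 < 1.03883 · 113 · 2048`).
[cite: RosserSchoenfeld1962, Theorem 12] -/
theorem psi_113_lt : ψ (113 : ℝ) < 1.03883 * 113 := by
  have h := log_window_113.1
  have hl2 := Real.log_two_lt_d9
  rw [psi_113_eq]
  nlinarith

/-- **`1.0388 · 113 < ψ(113)`** (`2^{346829} ≤ L_{113}^{2048}`, `1.0388 · 113 · 2048 < 346829 · 0.6931471803`).
[cite: RosserSchoenfeld1962, Theorem 12] -/
theorem psi_113_gt : 1.0388 * 113 < ψ (113 : ℝ) := by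
  have h := log_window_113.2
  have hl2 := Real.log_two_gt_d9
  rw [psi_113_eq]
  nlinarith

/-- `1.0388 < ψ(113)/113 < 1.03883`. [cite: RosserSchoenfeld1962, Theorem 12] -/
theorem psi_113_div_bounds : 1.0388 < ψ (113 : ℝ) / 113 ∧ ψ (113 : ℝ) / 113 < 1.03883 := by
  constructor
  · rw [lt_div_iff₀ (by norm_num : (0 : ℝ) < 113)]; linarith [psi_113_gt]
  · rw [div_lt_iff₀ (by norm_num : (0 : ℝ) < 113)]; linarith [psi_113_lt]

/-- **Real form of the certificate: `ψ(x) < 1.0388 x` for `0 < x < 40001` with `⌊x⌋ ≠ 113`.**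
[cite: RosserSchoenfeld1962, Theorem 12] -/
theorem psi_lt_of_floor_ne {x : ℝ} (hx : 0 < x) (hx' : x < 40001) (h113 : ⌊x⌋₊ ≠ 113) :
    ψ x < 1.0388 * x := by
  rw [Chebyshev.psi_eq_psi_coe_floor]
  rcases Nat.eq_zero_or_pos ⌊x⌋₊ with h0 | hpos
  · rw [h0, Nat.cast_zero, Chebyshev.psi_zero]; positivity
  · have hfl : (⌊x⌋₊ : ℝ) ≤ x := Nat.floor_le hx.le
    have hn : ⌊x⌋₊ < 40001 := (Nat.floor_lt hx.le).2 (by exact_mod_cast hx')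
    have := psi_nat_lt hpos (by omega) h113
    linarith

/-- On the window `⌊x⌋ = 113`: `ψ(x) = ψ(113)` and `113 ≤ x < 114`. [folklore] -/
private theorem psi_eq_of_floor_eq {x : ℝ} (hx : 0 ≤ x) (h113 : ⌊x⌋₊ = 113) : ψ x = ψ 113 ∧ 113 ≤ x ∧ x < 114 := by
  have hfl : (⌊x⌋₊ : ℝ) ≤ x := Nat.floor_le hx
  have hlt := Nat.lt_floor_add_one x
  rw [h113] at hfl hlt
  push_cast at hfl hlt
  refine ⟨?_, hfl, by linarith⟩
  rw [Chebyshev.psi_eq_psi_coe_floor, h113]; norm_num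

/-- **`ψ(x) < 1.0388 x` for `x ≥ 40000`**, from the tree's unconditional
`ψ(x) − x ≤ 0.00862 x + 5.72 √x` (`PsiFromZeros2516.psi_sub_self_le`; COMPUTATIONAL axiom closure —
certified zeros of `ζ` below height `2516`) and `5.72 √x ≤ 0.0286 x` for `√x ≥ 200`.
[cite: RosserSchoenfeld1975, Lemma 8] -/
theorem psi_lt_of_ge_forty_thousand {x : ℝ} (hx : 40000 ≤ x) : ψ x < 1.0388 * x := by
  have hx0 : 0 < x := by linarith
  have h := PsiFromZeros2516.psi_sub_self_le (show (9 : ℝ) ≤ x by linarith)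
  have hsq : Real.sqrt x * Real.sqrt x = x := Real.mul_self_sqrt hx0.le
  have h200 : (200 : ℝ) ≤ Real.sqrt x := by
    rw [show (200 : ℝ) = Real.sqrt (200 ^ 2) by rw [Real.sqrt_sq (by norm_num)]]
    exact Real.sqrt_le_sqrt (by nlinarith)
  have hs : 5.72 * Real.sqrt x ≤ 0.0286 * x := by nlinarith
  linarith

end RosserSchoenfeldPsi

open RosserSchoenfeldPsi

/-! ## Theorem 12, unconditional -/

/-- **`ψ(x) < 1.03883 x` for every real `x > 0`** (Rosser–Schoenfeld 1962, Theorem 12, (3.35)),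
unconditionally: kernel certificate below `40001`, `PsiFromZeros2516.psi_sub_self_le` above
(COMPUTATIONAL axiom closure through the latter). [cite: RosserSchoenfeld1962, Theorem 12, eq. (3.35)] -/
theorem psi_lt_rosserSchoenfeld {x : ℝ} (hx : 0 < x) : ψ x < 1.03883 * x := by
  rcases lt_or_ge x 40001 with hsm | hlg
  · by_cases h113 : ⌊x⌋₊ = 113
    · obtain ⟨hψ, h1, -⟩ := psi_eq_of_floor_eq hx.le h113
      rw [hψ]; linarith [psi_113_lt]
    · linarith [psi_lt_of_floor_ne hx hsm h113]
  · linarith [psi_lt_of_ge_forty_thousand (show (40000 : ℝ) ≤ x by linarith)]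

/-- **`ψ(x)/x ≤ ψ(113)/113` for every real `x > 0`** — "the quotient `ψ(x)/x` takes its maximum at
`x = 113`" (Rosser–Schoenfeld 1962, Theorem 12, first clause), unconditionally (COMPUTATIONAL axiom
closure above `40000`). [cite: RosserSchoenfeld1962, Theorem 12] -/
theorem psi_div_le_psi_div_113 {x : ℝ} (hx : 0 < x) : ψ x / x ≤ ψ 113 / 113 := by
  have hq := psi_113_div_bounds.1
  rw [div_le_iff₀ hx]
  rcases lt_or_ge x 40001 with hsm | hlg
  · by_cases h113 : ⌊x⌋₊ = 113
    · obtain ⟨hψ, h1, -⟩ := psi_eq_of_floor_eq hx.le h113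
      have hψ0 : 0 ≤ ψ (113 : ℝ) := Chebyshev.psi_nonneg _
      rw [hψ]
      have : ψ (113 : ℝ) = ψ 113 / 113 * 113 := by field_simp
      nlinarith
    · nlinarith [psi_lt_of_floor_ne hx hsm h113]
  · nlinarith [psi_lt_of_ge_forty_thousand (show (40000 : ℝ) ≤ x by linarith)]

/-- **Rosser–Schoenfeld 1962, Theorem 12, (3.35) — DISCHARGED**: the named fact
`RosserSchoenfeld1962_theorem_12` (`∀ x > 0, ψ(x) < 1.03883 x`) holds. Axiom closure COMPUTATIONAL
(certified zeros of `ζ` below height `2516` via `PsiFromZeros2516.psi_sub_self_le`); the printed first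
clause is `psi_div_le_psi_div_113`. [cite: RosserSchoenfeld1962, Theorem 12, eq. (3.35), p. 71] -/
theorem RosserSchoenfeld1962_theorem_12_holds : RosserSchoenfeld1962_theorem_12 :=
  fun _ hx ↦ psi_lt_rosserSchoenfeld hx

/-- **The Weil-column consumer's shape, unconditionally: `ψ(x) ≤ (103883/100000) x` for `x ≥ 0`**
(= hypothesis `hRS` of `ThetaParams.uc_of_loss_lt_gain` with `rsConst` unfolded; gm-t2's bridge
`psi_le_of_RosserSchoenfeld1962_theorem_12` fed with the discharge).
[cite: RosserSchoenfeld1962, Theorem 12, eq. (3.35)] -/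
theorem psi_le_rosserSchoenfeld {x : ℝ} (hx : 0 ≤ x) : ψ x ≤ (103883 / 100000 : ℝ) * x :=
  psi_le_of_RosserSchoenfeld1962_theorem_12 RosserSchoenfeld1962_theorem_12_holds x hx

/-- **Standard-axiom record of the small range: `ψ(x) < 1.03883 x` for `0 < x ≤ 40000`** (the kernel
certificate alone; no zeros of `ζ`). [cite: RosserSchoenfeld1962, Theorem 12, eq. (3.35)] -/
theorem psi_lt_of_le_forty_thousand {x : ℝ} (hx : 0 < x) (hx' : x ≤ 40000) : ψ x < 1.03883 * x := by
  have hsm : x < 40001 := by linarith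
  by_cases h113 : ⌊x⌋₊ = 113
  · obtain ⟨hψ, h1, -⟩ := psi_eq_of_floor_eq hx.le h113
    rw [hψ]; linarith [psi_113_lt]
  · linarith [psi_lt_of_floor_ne hx hsm h113]

end Literature.NumberTheory.LFunctions
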